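import Mathlib
import HarnessLib
import Summits.Ventures.LatticeQCDFlow.Scoring.ChainBlockSumMoments
import Summits.Ventures.LatticeQCDFlow.Scoring.ChainBlockDecorrelation

/-!
# The covariance structure of the squared batch sums of a Doeblin chain, from any start:
# `Var(U_j) ≤ K₄` and `|Cov(U_j, U_k)| ≤ K₅ ρ^{|j−k|}/b` uniformly in the initial law

HONEST FRAMING: exact (Metropolis-corrected) sampling algorithms for lattice gauge theory;
figures of merit are autocorrelation/cost numbers at stated couplings and volumes; no
continuum-physics claim.

Venture `LatticeQCDFlow` (cell pub-lqcd), topic `Scoring`; FANOUT row 8 (`s0-cpn-nemc`, GEN-19).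
NEW WORK of the cell, not a published result; no definition is introduced.  Setting: `κ` Markov with
invariant probability `π`, minorised by a probability law `ν` (`κ(x, ·) ≥ ε ν`, `0 < ε < 1`,
`e = ε.toReal`, `ρ = 1 − e`); `|f| ≤ C` measurable, `f̄ = f − π f`; `P_{μ₀}` the chain's path law from
ANY initial law.  Along the run the `j`-th BATCH of length `b` is `X_{bj}, …, X_{bj+b−1}`; write
`S_j = Σ_{i<b} f̄(X_{bj+i})` and `U_j = S_j²/b` (so that `E U_j → σ²_f`, the Green–Kubo variance, as
`b → ∞`: `Scoring/ChainBlockSumMoments.lean`).  This file bounds the second-order structure of the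
`U_j` uniformly in the initial law: the diagonal by the fourth-moment bound
(`chain_blockSum_fourth_le_minorised`: `E U_j² ≤ 512 (4C/e)⁴`), the off-diagonal by the block
decorrelation (`Scoring/ChainBlockDecorrelation.chain_dependsOn_blockSq_decorrelation` with `G = U_j`,
which depends only on times `≤ bj + b − 1`, and the later batch `k > j` starting `b(k−j−1)+1 ≥ k−j`
steps after: `|E[U_j U_k] − E U_j E U_k| ≤ K_dec · 10(4C/e)² · ρ^{k−j} / b`); the `a × a` sum (the
variance of the empirical mean of the `U_j`, `≤ K₄/a + K₆/b`) is taken in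
`Scoring/BatchMeansVariance.lean` — together the variance half of the consistency of the batch-means
estimator (`Scoring/BatchMeansConsistency.lean`).
Printed counterpart NAMED ONLY, nothing cited as a fact: consistency of non-overlapping batch means
(Glynn–Whitt 1991; Damerdji 1994; Flegal–Jones 2010).

## Content (hypotheses as above; `a, b ≥ 1`; `K₄ = 512 (4C/e)⁴`, `K₂ = 10 (4C/e)²`,
## `K_dec = 4 (2C)² (1+ρ)/(1−ρ)²`)

* `batchSum_dependsOn`, `batchSq_bounded_measurable` — bookkeeping for `U_j`;
* **`chain_batchSq_sq_le`** — `E_{μ₀}[U_j²] ≤ K₄`;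
* **`chain_batchSq_offdiag_le`** — `j < k`: `|E[U_j U_k] − E[U_j] E[U_k]| ≤ K_dec K₂ ρ^{k−j} / b`;
* **`chain_batchSq_cov_le`** — all `j, k`:
  `|E[U_j U_k] − E[U_j] E[U_k]| ≤ K₄ · 1{j = k} + (K_dec K₂ / b) ρ^{|j−k|}`;
(the `a × a` sum — the variance of the mean of the `U_j` — is `Scoring/BatchMeansVariance.lean`).

NOT CLAIMED: sharp constants or rates; overlapping batches; unbounded observables.
-/

noncomputable section

namespace Summit.Ventures.LatticeQCDFlow.Scoring

open MeasureTheory ProbabilityTheory Filter Finset Preorder Literature.Probability.MarkovChains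
open scoped ENNReal Topology

variable {Ω : Type*} [MeasurableSpace Ω]

/-! ### Bookkeeping for the squared batch sums -/

section Bookkeeping

omit [MeasurableSpace Ω] in
/-- The `j`-th batch sum depends only on the coordinates up to time `b j + b'` (`b = b' + 1`). -/
theorem batchSum_dependsOn (g : Ω → ℝ) (b' j : ℕ) :
    DependsOn (fun x : ℕ → Ω => ∑ i ∈ Finset.range (b' + 1), g (x ((b' + 1) * j + i)))
      (Set.Iic ((b' + 1) * j + b')) := by
  intro x y hxy
  refine Finset.sum_congr rfl fun i hi => ?_
  have hi' := Finset.mem_range.1 hi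
  rw [hxy ((b' + 1) * j + i) (Set.mem_Iic.2 (by omega))]

/-- `U_j = S_j²/b` is measurable and `|U_j| ≤ (b C')²/b` when `|g| ≤ C'`. -/
theorem batchSq_bounded_measurable {g : Ω → ℝ} (hg : Measurable g) {C' : ℝ} (hC' : ∀ y, |g y| ≤ C')
    (b j : ℕ) :
    Measurable (fun x : ℕ → Ω => (∑ i ∈ Finset.range b, g (x (b * j + i))) ^ 2 / b) ∧
      ∀ x : ℕ → Ω, |(∑ i ∈ Finset.range b, g (x (b * j + i))) ^ 2 / b| ≤ (b * C') ^ 2 / b := by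
  refine ⟨((Finset.measurable_sum _ fun i _ => hg.comp (measurable_pi_apply _)).pow_const 2).div_const
    _, fun x => ?_⟩
  have hS : |∑ i ∈ Finset.range b, g (x (b * j + i))| ≤ b * C' :=
    (Finset.abs_sum_le_sum_abs _ _).trans ((Finset.sum_le_sum fun i _ => hC' _).trans
      (by rw [Finset.sum_const, Finset.card_range, nsmul_eq_mul]))
  rw [abs_div, abs_pow, Nat.abs_cast]
  exact div_le_div_of_nonneg_right (pow_le_pow_left₀ (abs_nonneg _) hS 2) (Nat.cast_nonneg b)

end Bookkeeping

/-! ### Second-order structure of the squared batch sums -/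

section Covariance

variable {κ : Kernel Ω Ω} [IsMarkovKernel κ] {ν : Measure Ω} [IsProbabilityMeasure ν] {ε : ℝ≥0∞}
  {π : Measure Ω} [IsProbabilityMeasure π]

/-- **Diagonal: `E_{μ₀}[U_j²] ≤ 512 (4C/e)⁴`** (`b ≥ 1`), from the fourth-moment bound. -/
theorem chain_batchSq_sq_le (hπ : Kernel.Invariant κ π)
    (hmin : ∀ x {B : Set Ω}, MeasurableSet B → ε * ν B ≤ κ x B) (hε0 : 0 < ε) (hε : ε < 1)
    {f : Ω → ℝ} (hf : Measurable f) {C : ℝ} (hC : ∀ x, |f x| ≤ C)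
    (μ₀ : Measure Ω) [IsProbabilityMeasure μ₀] {b : ℕ} (hb : b ≠ 0) (j : ℕ) :
    ∫ x, ((∑ i ∈ Finset.range b, (f (x (b * j + i)) - ∫ z, f z ∂π)) ^ 2 / b) ^ 2
        ∂(Kernel.trajMeasure (X := fun _ : ℕ => Ω) μ₀
          (fun n : ℕ => κ.comap (fun h : (i : ↥(Finset.Iic n)) → Ω => h ⟨n, Finset.mem_Iic.2 le_rfl⟩)
            (measurable_pi_apply _)))
      ≤ 512 * (4 * C / ε.toReal) ^ 4 := by
  have h4 := chain_blockSum_fourth_le_minorised (κ := κ) (ν := ν) hπ hmin hε0 hε hf hC μ₀ (b * j) hb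
  have hb0 : (0 : ℝ) < b := Nat.cast_pos.2 (Nat.pos_of_ne_zero hb)
  have hpt : ∀ x : ℕ → Ω, ((∑ i ∈ Finset.range b, (f (x (b * j + i)) - ∫ z, f z ∂π)) ^ 2 / b) ^ 2
      = (∑ i ∈ Finset.range b, (f (x (b * j + i)) - ∫ z, f z ∂π)) ^ 4 / (b : ℝ) ^ 2 := fun x => by
    rw [div_pow, ← pow_mul]
  rw [integral_congr_ae (ae_of_all _ hpt), integral_div]
  calc (∫ x, (∑ i ∈ Finset.range b, (f (x (b * j + i)) - ∫ z, f z ∂π)) ^ 4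
        ∂(Kernel.trajMeasure (X := fun _ : ℕ => Ω) μ₀
          (fun n : ℕ => κ.comap (fun h : (i : ↥(Finset.Iic n)) → Ω => h ⟨n, Finset.mem_Iic.2 le_rfl⟩)
            (measurable_pi_apply _)))) / (b : ℝ) ^ 2
      ≤ (512 * (4 * C / ε.toReal) ^ 4 * (b : ℝ) ^ 2) / (b : ℝ) ^ 2 :=
        div_le_div_of_nonneg_right h4 (by positivity)
    _ = 512 * (4 * C / ε.toReal) ^ 4 := by field_simp

/-- **Off-diagonal: for `j < k`, `|E[U_j U_k] − E[U_j] E[U_k]| ≤ K_dec K₂ ρ^{k−j} / b`** with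
`K_dec = 4 (2C)² (1+ρ)/(1−ρ)²`, `K₂ = 10 (4C/e)²` — the later batch starts `b(k−j−1)+1 ≥ k−j` steps
after the earlier one ends. -/
theorem chain_batchSq_offdiag_le (hπ : Kernel.Invariant κ π)
    (hmin : ∀ x {B : Set Ω}, MeasurableSet B → ε * ν B ≤ κ x B) (hε0 : 0 < ε) (hε : ε < 1)
    {f : Ω → ℝ} (hf : Measurable f) {C : ℝ} (hC : ∀ x, |f x| ≤ C)
    (μ₀ : Measure Ω) [IsProbabilityMeasure μ₀] {b : ℕ} (hb : b ≠ 0) {j k : ℕ} (hjk : j < k) :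
    |∫ x, ((∑ i ∈ Finset.range b, (f (x (b * j + i)) - ∫ z, f z ∂π)) ^ 2 / b)
          * ((∑ i ∈ Finset.range b, (f (x (b * k + i)) - ∫ z, f z ∂π)) ^ 2 / b)
        ∂(Kernel.trajMeasure (X := fun _ : ℕ => Ω) μ₀
          (fun n : ℕ => κ.comap (fun h : (i : ↥(Finset.Iic n)) → Ω => h ⟨n, Finset.mem_Iic.2 le_rfl⟩)
            (measurable_pi_apply _)))
      - (∫ x, (∑ i ∈ Finset.range b, (f (x (b * j + i)) - ∫ z, f z ∂π)) ^ 2 / b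
        ∂(Kernel.trajMeasure (X := fun _ : ℕ => Ω) μ₀
          (fun n : ℕ => κ.comap (fun h : (i : ↥(Finset.Iic n)) → Ω => h ⟨n, Finset.mem_Iic.2 le_rfl⟩)
            (measurable_pi_apply _))))
        * ∫ x, (∑ i ∈ Finset.range b, (f (x (b * k + i)) - ∫ z, f z ∂π)) ^ 2 / b
        ∂(Kernel.trajMeasure (X := fun _ : ℕ => Ω) μ₀
          (fun n : ℕ => κ.comap (fun h : (i : ↥(Finset.Iic n)) → Ω => h ⟨n, Finset.mem_Iic.2 le_rfl⟩)
            (measurable_pi_apply _)))|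
      ≤ 4 * (2 * C) ^ 2 * ((1 + (1 - ε.toReal)) / (1 - (1 - ε.toReal)) ^ 2)
        * (10 * (4 * C / ε.toReal) ^ 2) * (1 - ε.toReal) ^ (k - j) / b := by
  set P := Kernel.trajMeasure (X := fun _ : ℕ => Ω) μ₀
      (fun n : ℕ => κ.comap (fun h : (i : ↥(Finset.Iic n)) → Ω => h ⟨n, Finset.mem_Iic.2 le_rfl⟩)
        (measurable_pi_apply _)) with hP
  obtain ⟨-, hl0, he1⟩ := one_sub_toReal_eq_of_lt_one (ε := ε) hε
  have he0 : 0 < ε.toReal := ENNReal.toReal_pos hε0.ne' (ne_top_of_lt hε)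
  have hl1 : 1 - ε.toReal < 1 := by linarith
  set ρ := 1 - ε.toReal with hρ
  set c := ∫ z, f z ∂π with hc
  obtain ⟨hfb, hCfb, -⟩ := centred_observable_bounds π hf hC
  obtain ⟨b', rfl⟩ : ∃ b', b = b' + 1 := ⟨b - 1, (Nat.succ_pred_eq_of_pos (Nat.pos_of_ne_zero hb)).symm⟩
  obtain ⟨m, rfl⟩ : ∃ m, k = j + m + 1 := ⟨k - j - 1, by omega⟩
  have hb0 : (0 : ℝ) < ((b' + 1 : ℕ) : ℝ) := Nat.cast_pos.2 (Nat.succ_pos b')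
  -- `G = U_j`
  obtain ⟨hGm, hGb⟩ := batchSq_bounded_measurable hfb hCfb (b' + 1) j
  have hGd : DependsOn (fun x : ℕ → Ω =>
      (∑ i ∈ Finset.range (b' + 1), (f (x ((b' + 1) * j + i)) - c)) ^ 2 / ((b' + 1 : ℕ) : ℝ))
      (Set.Iic ((b' + 1) * j + b')) := by
    intro x y hxy
    exact congrArg (fun t : ℝ => t ^ 2 / ((b' + 1 : ℕ) : ℝ))
      (batchSum_dependsOn (fun z => f z - c) b' j hxy)
  -- the decorrelation with gap `g = (b'+1) m + 1`
  have key := chain_dependsOn_blockSq_decorrelation (κ := κ) (ν := ν) (μ₀ := μ₀) hπ hmin hε0 hε hf hC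
    ((b' + 1) * j + b') ((b' + 1) * m + 1) (b' + 1) hGm hGd hGb
  rw [← hP] at key
  -- the later block is the `k`-th batch
  have hidx : ∀ l, (b' + 1) * j + b' + ((b' + 1) * m + 1) + l = (b' + 1) * (j + m + 1) + l :=
    fun l => by ring
  simp only [hidx] at key
  -- `∫ |U_j| = E[S_j²]/b ≤ K₂`
  have hS2 := chain_blockSum_sq_le_minorised (κ := κ) (ν := ν) hπ hmin hε0 hε hf hC μ₀ ((b' + 1) * j)
    (Nat.succ_ne_zero b')
  rw [← hP] at hS2
  have hIG : ∫ x, |(∑ i ∈ Finset.range (b' + 1), (f (x ((b' + 1) * j + i)) - c)) ^ 2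
      / ((b' + 1 : ℕ) : ℝ)| ∂P ≤ 10 * (4 * C / ε.toReal) ^ 2 := by
    have habs : ∀ x : ℕ → Ω, |(∑ i ∈ Finset.range (b' + 1), (f (x ((b' + 1) * j + i)) - c)) ^ 2
        / ((b' + 1 : ℕ) : ℝ)|
        = (∑ i ∈ Finset.range (b' + 1), (f (x ((b' + 1) * j + i)) - c)) ^ 2 / ((b' + 1 : ℕ) : ℝ) :=
      fun x => abs_of_nonneg (div_nonneg (sq_nonneg _) hb0.le)
    rw [integral_congr_ae (ae_of_all _ habs), integral_div]
    calc (∫ x, (∑ i ∈ Finset.range (b' + 1), (f (x ((b' + 1) * j + i)) - c)) ^ 2 ∂P)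
          / ((b' + 1 : ℕ) : ℝ)
        ≤ (10 * (4 * C / ε.toReal) ^ 2 * ((b' + 1 : ℕ) : ℝ)) / ((b' + 1 : ℕ) : ℝ) :=
          div_le_div_of_nonneg_right hS2 hb0.le
      _ = 10 * (4 * C / ε.toReal) ^ 2 := by field_simp
  -- divide the decorrelation by `b` (the `k`-th factor is `S_k²/b`)
  have hKdec0 : 0 ≤ 4 * (2 * C) ^ 2 * ((1 + ρ) / (1 - ρ) ^ 2) * ρ ^ ((b' + 1) * m + 1) := by
    have : 0 ≤ (1 + ρ) / (1 - ρ) ^ 2 := div_nonneg (by linarith) (sq_nonneg _)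
    positivity
  have key' := mul_le_mul_of_nonneg_left hIG hKdec0
  have key2 := key.trans key'
  -- rewrite the products with `/ b`
  have hL : ∫ x, (∑ i ∈ Finset.range (b' + 1), (f (x ((b' + 1) * j + i)) - c)) ^ 2 / ((b' + 1 : ℕ) : ℝ)
        * ((∑ i ∈ Finset.range (b' + 1), (f (x ((b' + 1) * (j + m + 1) + i)) - c)) ^ 2
          / ((b' + 1 : ℕ) : ℝ)) ∂P
      = (∫ x, (∑ i ∈ Finset.range (b' + 1), (f (x ((b' + 1) * j + i)) - c)) ^ 2 / ((b' + 1 : ℕ) : ℝ)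
        * (∑ i ∈ Finset.range (b' + 1), (f (x ((b' + 1) * (j + m + 1) + i)) - c)) ^ 2 ∂P)
        / ((b' + 1 : ℕ) : ℝ) := by
    rw [← integral_div]
    exact integral_congr_ae (ae_of_all _ fun x => by ring)
  have hR : ∫ x, (∑ i ∈ Finset.range (b' + 1), (f (x ((b' + 1) * (j + m + 1) + i)) - c)) ^ 2
        / ((b' + 1 : ℕ) : ℝ) ∂P
      = (∫ x, (∑ i ∈ Finset.range (b' + 1), (f (x ((b' + 1) * (j + m + 1) + i)) - c)) ^ 2 ∂P)
        / ((b' + 1 : ℕ) : ℝ) := integral_div _ _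
  rw [hL, hR]
  have hdist : j + m + 1 - j = m + 1 := by omega
  rw [hdist]
  have hρg : ρ ^ ((b' + 1) * m + 1) ≤ ρ ^ (m + 1) :=
    pow_le_pow_of_le_one hl0 hl1.le (by nlinarith [Nat.zero_le (b' * m)])
  have hfinal : |(∫ x, (∑ i ∈ Finset.range (b' + 1), (f (x ((b' + 1) * j + i)) - c)) ^ 2
        / ((b' + 1 : ℕ) : ℝ)
        * (∑ i ∈ Finset.range (b' + 1), (f (x ((b' + 1) * (j + m + 1) + i)) - c)) ^ 2 ∂P)
        / ((b' + 1 : ℕ) : ℝ)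
      - (∫ x, (∑ i ∈ Finset.range (b' + 1), (f (x ((b' + 1) * j + i)) - c)) ^ 2
        / ((b' + 1 : ℕ) : ℝ) ∂P)
        * ((∫ x, (∑ i ∈ Finset.range (b' + 1), (f (x ((b' + 1) * (j + m + 1) + i)) - c)) ^ 2 ∂P)
          / ((b' + 1 : ℕ) : ℝ))|
      = |∫ x, (∑ i ∈ Finset.range (b' + 1), (f (x ((b' + 1) * j + i)) - c)) ^ 2
          / ((b' + 1 : ℕ) : ℝ)
          * (∑ i ∈ Finset.range (b' + 1), (f (x ((b' + 1) * (j + m + 1) + i)) - c)) ^ 2 ∂P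
        - (∫ x, (∑ i ∈ Finset.range (b' + 1), (f (x ((b' + 1) * j + i)) - c)) ^ 2
          / ((b' + 1 : ℕ) : ℝ) ∂P)
          * ∫ x, (∑ i ∈ Finset.range (b' + 1), (f (x ((b' + 1) * (j + m + 1) + i)) - c)) ^ 2 ∂P|
        / ((b' + 1 : ℕ) : ℝ) := by
    rw [← abs_of_pos hb0, ← abs_div, abs_of_pos hb0]
    congr 1
    field_simp
  rw [hfinal]
  refine (div_le_div_of_nonneg_right key2 hb0.le).trans ?_
  refine div_le_div_of_nonneg_right ?_ hb0.le
  have h10 : 0 ≤ 10 * (4 * C / ε.toReal) ^ 2 := by positivity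
  have hK0 : 0 ≤ 4 * (2 * C) ^ 2 * ((1 + ρ) / (1 - ρ) ^ 2) := by
    have : 0 ≤ (1 + ρ) / (1 - ρ) ^ 2 := div_nonneg (by linarith) (sq_nonneg _)
    positivity
  calc 4 * (2 * C) ^ 2 * ((1 + ρ) / (1 - ρ) ^ 2) * ρ ^ ((b' + 1) * m + 1) * (10 * (4 * C / ε.toReal) ^ 2)
      ≤ 4 * (2 * C) ^ 2 * ((1 + ρ) / (1 - ρ) ^ 2) * ρ ^ (m + 1) * (10 * (4 * C / ε.toReal) ^ 2) :=
        mul_le_mul_of_nonneg_right (mul_le_mul_of_nonneg_left hρg hK0) h10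
    _ = 4 * (2 * C) ^ 2 * ((1 + ρ) / (1 - ρ) ^ 2) * (10 * (4 * C / ε.toReal) ^ 2) * ρ ^ (m + 1) := by
        ring

/-- **All pairs: `|E[U_j U_k] − E[U_j] E[U_k]| ≤ K₄ · 1{j = k} + (K_dec K₂ / b) ρ^{|j − k|}`.** -/
theorem chain_batchSq_cov_le (hπ : Kernel.Invariant κ π)
    (hmin : ∀ x {B : Set Ω}, MeasurableSet B → ε * ν B ≤ κ x B) (hε0 : 0 < ε) (hε : ε < 1)
    {f : Ω → ℝ} (hf : Measurable f) {C : ℝ} (hC : ∀ x, |f x| ≤ C)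
    (μ₀ : Measure Ω) [IsProbabilityMeasure μ₀] {b : ℕ} (hb : b ≠ 0) (j k : ℕ) :
    |∫ x, ((∑ i ∈ Finset.range b, (f (x (b * j + i)) - ∫ z, f z ∂π)) ^ 2 / b)
          * ((∑ i ∈ Finset.range b, (f (x (b * k + i)) - ∫ z, f z ∂π)) ^ 2 / b)
        ∂(Kernel.trajMeasure (X := fun _ : ℕ => Ω) μ₀
          (fun n : ℕ => κ.comap (fun h : (i : ↥(Finset.Iic n)) → Ω => h ⟨n, Finset.mem_Iic.2 le_rfl⟩)
            (measurable_pi_apply _)))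
      - (∫ x, (∑ i ∈ Finset.range b, (f (x (b * j + i)) - ∫ z, f z ∂π)) ^ 2 / b
        ∂(Kernel.trajMeasure (X := fun _ : ℕ => Ω) μ₀
          (fun n : ℕ => κ.comap (fun h : (i : ↥(Finset.Iic n)) → Ω => h ⟨n, Finset.mem_Iic.2 le_rfl⟩)
            (measurable_pi_apply _))))
        * ∫ x, (∑ i ∈ Finset.range b, (f (x (b * k + i)) - ∫ z, f z ∂π)) ^ 2 / b
        ∂(Kernel.trajMeasure (X := fun _ : ℕ => Ω) μ₀
          (fun n : ℕ => κ.comap (fun h : (i : ↥(Finset.Iic n)) → Ω => h ⟨n, Finset.mem_Iic.2 le_rfl⟩)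
            (measurable_pi_apply _)))|
      ≤ 512 * (4 * C / ε.toReal) ^ 4 * (if j = k then 1 else 0)
        + 4 * (2 * C) ^ 2 * ((1 + (1 - ε.toReal)) / (1 - (1 - ε.toReal)) ^ 2)
          * (10 * (4 * C / ε.toReal) ^ 2) / b * (1 - ε.toReal) ^ (Nat.dist j k) := by
  set P := Kernel.trajMeasure (X := fun _ : ℕ => Ω) μ₀
      (fun n : ℕ => κ.comap (fun h : (i : ↥(Finset.Iic n)) → Ω => h ⟨n, Finset.mem_Iic.2 le_rfl⟩)
        (measurable_pi_apply _)) with hP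
  obtain ⟨-, hl0, he1⟩ := one_sub_toReal_eq_of_lt_one (ε := ε) hε
  have he0 : 0 < ε.toReal := ENNReal.toReal_pos hε0.ne' (ne_top_of_lt hε)
  set ρ := 1 - ε.toReal with hρ
  set c := ∫ z, f z ∂π with hc
  have hb0 : (0 : ℝ) < b := Nat.cast_pos.2 (Nat.pos_of_ne_zero hb)
  have hoff0 : 0 ≤ 4 * (2 * C) ^ 2 * ((1 + ρ) / (1 - ρ) ^ 2) * (10 * (4 * C / ε.toReal) ^ 2) / b
      * ρ ^ (Nat.dist j k) := by
    have : 0 ≤ (1 + ρ) / (1 - ρ) ^ 2 := div_nonneg (by linarith) (sq_nonneg _)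
    positivity
  rcases lt_trichotomy j k with hjk | rfl | hkj
  · -- `j < k`
    have h := chain_batchSq_offdiag_le (κ := κ) (ν := ν) hπ hmin hε0 hε hf hC μ₀ hb hjk
    rw [← hP] at h
    rw [if_neg hjk.ne, mul_zero, zero_add, Nat.dist_eq_sub_of_le hjk.le]
    exact h.trans (le_of_eq (by ring))
  · -- `j = k`: the variance is at most the second moment
    rw [if_pos rfl, mul_one, Nat.dist_self, pow_zero, mul_one]
    obtain ⟨hfb, hCfb, -⟩ := centred_observable_bounds π hf hC
    obtain ⟨hUm, hUb⟩ := batchSq_bounded_measurable hfb hCfb b j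
    have hsq := chain_batchSq_sq_le (κ := κ) (ν := ν) hπ hmin hε0 hε hf hC μ₀ hb j
    rw [← hP] at hsq
    have hU2 : ∫ x, (∑ i ∈ Finset.range b, (f (x (b * j + i)) - c)) ^ 2 / b
        * ((∑ i ∈ Finset.range b, (f (x (b * j + i)) - c)) ^ 2 / b) ∂P
        = ∫ x, ((∑ i ∈ Finset.range b, (f (x (b * j + i)) - c)) ^ 2 / b) ^ 2 ∂P :=
      integral_congr_ae (ae_of_all _ fun x => by ring)
    rw [hU2]
    have hm0 : 0 ≤ ∫ x, (∑ i ∈ Finset.range b, (f (x (b * j + i)) - c)) ^ 2 / b ∂P :=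
      integral_nonneg fun x => div_nonneg (sq_nonneg _) hb0.le
    have hE2 : 0 ≤ ∫ x, ((∑ i ∈ Finset.range b, (f (x (b * j + i)) - c)) ^ 2 / b) ^ 2 ∂P :=
      integral_nonneg fun x => sq_nonneg _
    -- `(E U)² ≤ E[U²]`
    have hJ := sq_integral_le_integral_sq P hUm hUb
    rw [← hc] at hsq hJ
    have hK4 : 0 ≤ 512 * (4 * C / ε.toReal) ^ 4 := by positivity
    have hK5 : 0 ≤ 4 * (2 * C) ^ 2 * ((1 + ρ) / (1 - ρ) ^ 2) * (10 * (4 * C / ε.toReal) ^ 2) / b := by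
      have : 0 ≤ (1 + ρ) / (1 - ρ) ^ 2 := div_nonneg (by linarith) (sq_nonneg _)
      positivity
    rw [abs_le]
    constructor
    · nlinarith [mul_self_nonneg (∫ x, (∑ i ∈ Finset.range b, (f (x (b * j + i)) - c)) ^ 2 / b ∂P)]
    · nlinarith [mul_self_nonneg (∫ x, (∑ i ∈ Finset.range b, (f (x (b * j + i)) - c)) ^ 2 / b ∂P)]
  · -- `k < j`: symmetry
    have h := chain_batchSq_offdiag_le (κ := κ) (ν := ν) hπ hmin hε0 hε hf hC μ₀ hb hkj
    rw [← hP] at h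
    rw [if_neg hkj.ne', mul_zero, zero_add, Nat.dist_comm, Nat.dist_eq_sub_of_le hkj.le]
    have hsym1 : ∫ x, (∑ i ∈ Finset.range b, (f (x (b * j + i)) - c)) ^ 2 / b
        * ((∑ i ∈ Finset.range b, (f (x (b * k + i)) - c)) ^ 2 / b) ∂P
        = ∫ x, (∑ i ∈ Finset.range b, (f (x (b * k + i)) - c)) ^ 2 / b
        * ((∑ i ∈ Finset.range b, (f (x (b * j + i)) - c)) ^ 2 / b) ∂P :=
      integral_congr_ae (ae_of_all _ fun x => by ring)
    rw [hsym1, mul_comm (∫ x, (∑ i ∈ Finset.range b, (f (x (b * j + i)) - c)) ^ 2 / b ∂P)]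
    exact h.trans (le_of_eq (by ring))

end Covariance

end Summit.Ventures.LatticeQCDFlow.Scoring

end
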